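import Literature.Barriers.QuantumFields.UnitaryHaarSmallBall
import Literature.MathematicalPhysics.QuantumFieldTheory.SUNBakryEmeryPoincare
import Literature.Barriers.QuantumFields.CenterSymmetryBreakingByQuarks
import HarnessLib

/-!
# `RobustYangMillsRG` — negative side, part C₁: small `n`-th roots in `SU(3)` modulo the centre,
# and the dial elements of the wild blocking map

Support lemmas for the disproof of the crux `RobustYangMillsRG` (stmt-QuantumFields-14958): the
Lie-theoretic input of the zero fibre infimum.

* `exists_small_root` — for every `R ∈ SU(3)` and `n ≥ 1` there are `X ∈ SU(3)` and `j < 3` with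
  `X^n · ζ^j = R` and `‖X − 1‖_op ≤ 2π/n` (`ζ = e^{2πi/3}·1`): `R = e^{iH}` with `H = arg R` by the
  matrix functional calculus (`Literature.Barriers.QuantumFields.expUnitary_argSelfAdjoint_of_continuousOn`),
  `tr H = 2πm` (`det e^{iH} = e^{i tr H} = 1`, `|m| ≤ 1`), `H' = H − (2πm/3)·1` is traceless and
  `X = e^{iH'/n}` (`expSU`), `e^{2πim/3}·1 = ζ^j`; smallness by the `1`-Lipschitz bound
  `Literature.Barriers.QuantumFields.norm_expUnitary_sub_expUnitary_le`.
* `dial q = e^{iK/(q+1)}`, `K = diag(1,−1,0)`: `Re tr (dial q) = 1 + 2 cos(1/(q+1))` and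
  `‖dial q − 1‖_op ≤ 1/(q+1)` — the dial link values read by `decode`.
Norms are Mathlib's scoped `L²`-operator (C⋆) norm on `M₃(ℂ)`. [folklore]
-/

noncomputable section

open Complex NormedSpace selfAdjoint Unitary Matrix
open scoped Real Matrix.Norms.L2Operator

namespace Summit.QuantumFields.QCD.Theorems.RobustYangMillsRG.Negative

open Literature.Barriers.QuantumFields Literature.MathematicalPhysics.QuantumFieldTheory
  Literature.MathematicalPhysics.QuantumFieldTheory.SUNBakryEmery

/-- `SU(3)`. [folklore] -/
abbrev SU3' : Type := Matrix.specialUnitaryGroup (Fin 3) ℂ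

/-- `M₃(ℂ)`. [folklore] -/
abbrev M3 : Type := Matrix (Fin 3) (Fin 3) ℂ

/-- `|tr A| ≤ 3 ‖A‖_op` on `M₃(ℂ)`. [folklore] -/
theorem norm_trace_le (A : M3) : ‖A.trace‖ ≤ 3 * ‖A‖ := by
  rw [Matrix.trace, Fin.sum_univ_three]
  calc ‖A 0 0 + A 1 1 + A 2 2‖ ≤ ‖A 0 0‖ + ‖A 1 1‖ + ‖A 2 2‖ := norm_add₃_le
    _ ≤ ‖A‖ + ‖A‖ + ‖A‖ := by
        gcongr <;> exact norm_entry_le_l2_opNorm A _ _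
    _ = 3 * ‖A‖ := by ring

/-- `0 ≤ 3 − Re tr g` is bounded by `3 ‖g − 1‖_op` for any `3 × 3` matrix `g`. [folklore] -/
theorem three_sub_re_trace_le (g : M3) : 3 - g.trace.re ≤ 3 * ‖g - 1‖ := by
  have h1 : (3 : ℝ) - g.trace.re = ((1 : M3) - g).trace.re := by
    rw [trace_sub, sub_re, trace_one]; simp
  rw [h1, ← norm_neg, neg_sub]
  exact (re_le_norm _).trans ((norm_trace_le _).trans (by rw [← norm_neg, neg_sub]))

/-- Powers of a one-parameter group: `(exp (t Y))^k = exp ((k t) Y)`. [folklore] -/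
theorem exp_smul_pow (Y : M3) (t : ℝ) (k : ℕ) :
    (NormedSpace.exp (t • Y)) ^ k = NormedSpace.exp (((k : ℝ) * t) • Y) := by
  induction k with
  | zero => simp
  | succ k ih =>
    rw [pow_succ, ih, Nat.cast_succ, add_mul, one_mul, add_smul,
      Matrix.exp_add_of_commute _ _ (((Commute.refl Y).smul_left _).smul_right _)]

/-- The scalar exponential: `exp ((z) • 1) = e^z • 1` in `M₃(ℂ)`. [folklore] -/
theorem exp_smul_one (z : ℂ) : NormedSpace.exp (z • (1 : M3)) = Complex.exp z • (1 : M3) := by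
  rw [← Algebra.algebraMap_eq_smul_one, ← Algebra.algebraMap_eq_smul_one, ← algebraMap_exp_comm z,
    congrFun Complex.exp_eq_exp_ℂ z]

/-- **Small `n`-th roots modulo the centre in `SU(3)`.** For every `R ∈ SU(3)` and `n ≥ 1` there
are `X ∈ SU(3)` and `j < 3` with `X ^ n * ζ ^ j = R` and `‖X − 1‖_op ≤ 2π / n`. [folklore] -/
theorem exists_small_root (R : SU3') {n : ℕ} (hn : 1 ≤ n) :
    ∃ (X : SU3') (j : ℕ), j < 3 ∧
      X ^ n * (scalarCenter 3 (Complex.exp (2 * π * I / 3))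
        (Complex.isPrimitiveRoot_exp 3 (by norm_num)).pow_eq_one (by norm_num)) ^ j = R ∧
      ‖(X : M3) - 1‖ ≤ 2 * π / n := by
  letI : CStarAlgebra M3 := {}
  set ω : ℂ := Complex.exp (2 * π * I / 3) with hω
  have hω3 : ω ^ 3 = 1 := (Complex.isPrimitiveRoot_exp 3 (by norm_num)).pow_eq_one
  -- `R` as a unitary, its argument `H`
  set Ru : Matrix.unitaryGroup (Fin 3) ℂ := ⟨(R : M3), Matrix.specialUnitaryGroup_le_unitaryGroup R.2⟩
    with hRu
  set H : selfAdjoint M3 := argSelfAdjoint Ru with hH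
  have hexpH : expUnitary H = Ru :=
    expUnitary_argSelfAdjoint_of_continuousOn ((Matrix.finite_spectrum (Ru : M3)).continuousOn _)
  have hHπ : ‖(H : M3)‖ ≤ π := norm_argSelfAdjoint_le_pi Ru
  have hexpH' : NormedSpace.exp (I • (H : M3)) = (R : M3) := by
    have := congrArg (fun u : Matrix.unitaryGroup (Fin 3) ℂ => (u : M3)) hexpH
    simpa [expUnitary_coe] using this
  -- `tr H = 2 π m`
  have hdet : Complex.exp (I * (H : M3).trace) = 1 := by
    have h1 : ((R : M3)).det = 1 := (Matrix.mem_specialUnitaryGroup_iff.1 R.2).2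
    rw [← hexpH', Literature.Analysis.Matrix.det_exp_eq_exp_trace, trace_smul, smul_eq_mul,
      ← congrFun Complex.exp_eq_exp_ℂ] at h1
    exact h1
  obtain ⟨m, hm⟩ := Complex.exp_eq_one_iff.1 hdet
  have htr : (H : M3).trace = 2 * π * m := by
    linear_combination (-I) * hm + ((H : M3).trace - 2 * π * m) * I_mul_I
  -- `|m| ≤ 1`
  have hm1 : |m| ≤ 1 := by
    have h1 : ‖(H : M3).trace‖ ≤ 3 * π := (norm_trace_le _).trans (by nlinarith [hHπ, Real.pi_pos])
    rw [htr] at h1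
    have h2 : ‖(2 * π * m : ℂ)‖ = 2 * π * |(m : ℝ)| := by
      rw [norm_mul, norm_mul, Complex.norm_two, Complex.norm_real, Real.norm_of_nonneg Real.pi_pos.le,
        Complex.norm_intCast]
    rw [h2] at h1
    have h3 : |(m : ℝ)| < 2 := by nlinarith [Real.pi_gt_three]
    have h4 : |m| < 2 := by exact_mod_cast h3
    omega
  -- the traceless part
  set c : ℝ := 2 * π * m / 3 with hc
  have hcabs : |c| ≤ 2 * π / 3 := by
    rw [hc, abs_div, abs_mul, abs_of_pos (by positivity : (0 : ℝ) < 2 * π), abs_of_pos (by norm_num : (0:ℝ) < 3)]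
    have : |(m : ℝ)| ≤ 1 := by exact_mod_cast hm1
    nlinarith [Real.pi_pos]
  set H' : M3 := (H : M3) - (c : ℂ) • (1 : M3) with hH'
  have hH'sa : IsSelfAdjoint H' := by
    refine H.2.sub ?_
    rw [IsSelfAdjoint, star_smul, star_one, Complex.star_def, Complex.conj_ofReal]
  have hH'tr : H'.trace = 0 := by
    rw [hH', trace_sub, trace_smul, trace_one, htr, hc, smul_eq_mul, Fintype.card_fin]
    push_cast
    ring
  set Y : M3 := I • H' with hY
  have hYskew : Yᴴ = -Y := by
    rw [hY, conjTranspose_smul, ← Matrix.star_eq_conjTranspose, hH'sa.star_eq, Complex.star_def,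
      conj_I, neg_smul]
  have hYtr : Y.trace = 0 := by rw [hY, trace_smul, hH'tr, smul_zero]
  have hsplit : I • (H : M3) = Y + ((I * c : ℂ)) • (1 : M3) := by
    rw [hY, hH', smul_sub, smul_smul, sub_add_cancel]
  -- the root
  set X : SU3' := expSU hYskew hYtr ((n : ℝ)⁻¹) with hX
  -- the centre power
  obtain ⟨j, hj3, hωj⟩ : ∃ j : ℕ, j < 3 ∧ Complex.exp (I * c) = ω ^ j := by
    rcases Int.abs_le_one_iff.mp hm1 with h0 | h1 | h1
    · refine ⟨0, by norm_num, ?_⟩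
      rw [hc, h0]; simp
    · refine ⟨1, by norm_num, ?_⟩
      rw [pow_one, hω, hc, h1]; congr 1; push_cast; ring
    · refine ⟨2, by norm_num, ?_⟩
      rw [hω, ← Complex.exp_nat_mul, hc, h1,
        show (I * ((2 * π * ((-1 : ℤ) : ℝ) / 3 : ℝ) : ℂ)) =
          (2 : ℕ) * (2 * π * I / 3) + ((-1 : ℤ) : ℂ) * (2 * π * I) by push_cast; ring,
        Complex.exp_add, Complex.exp_int_mul_two_pi_mul_I, mul_one]
  refine ⟨X, j, hj3, ?_, ?_⟩
  · -- the identity `X^n ζ^j = R`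
    apply Subtype.ext
    change ((X ^ n : SU3') : M3) * ((scalarCenter 3 ω hω3 _ ^ j : SU3') : M3) = (R : M3)
    rw [SubmonoidClass.coe_pow, SubmonoidClass.coe_pow, hX, coe_expSU, exp_smul_pow,
      mul_inv_cancel₀ (by exact_mod_cast (show n ≠ 0 by omega)), one_smul]
    change NormedSpace.exp Y * (ω • (1 : M3)) ^ j = (R : M3)
    rw [smul_pow, one_pow, ← hωj, ← exp_smul_one, ← hexpH', hsplit]
    exact (Matrix.exp_add_of_commute _ _ ((Commute.one_right Y).smul_right _)).symm
  · -- smallness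
    set H'sa : selfAdjoint M3 := ⟨H', hH'sa⟩ with hH'sa'
    have hXcoe : (X : M3) = (expUnitary (((n : ℝ)⁻¹) • H'sa) : M3) := by
      rw [hX, coe_expSU, expUnitary_coe, selfAdjoint.val_smul, hY, smul_comm]
    have h1 : ‖(X : M3) - 1‖ ≤ ‖(((n : ℝ)⁻¹ • H'sa : selfAdjoint M3) : M3) - ((0 : selfAdjoint M3) : M3)‖ := by
      rw [hXcoe, ← show ((expUnitary (0 : selfAdjoint M3) : Matrix.unitaryGroup (Fin 3) ℂ) : M3) = 1 by
        rw [expUnitary_zero]; rfl]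
      exact norm_expUnitary_sub_expUnitary_le _ _
    have h2 : ‖(((n : ℝ)⁻¹ • H'sa : selfAdjoint M3) : M3) - ((0 : selfAdjoint M3) : M3)‖ =
        (n : ℝ)⁻¹ * ‖H'‖ := by
      rw [ZeroMemClass.coe_zero, sub_zero, selfAdjoint.val_smul, norm_smul, Real.norm_of_nonneg (by positivity)]
    have h3 : ‖H'‖ ≤ π + 2 * π / 3 := by
      rw [hH']
      calc ‖(H : M3) - (c : ℂ) • (1 : M3)‖ ≤ ‖(H : M3)‖ + ‖(c : ℂ) • (1 : M3)‖ := norm_sub_le _ _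
        _ ≤ π + 2 * π / 3 := by
            rw [norm_smul, CStarRing.norm_one, mul_one, Complex.norm_real, Real.norm_eq_abs]
            exact add_le_add hHπ hcabs
    have hn0 : (0 : ℝ) < n := by exact_mod_cast hn
    calc ‖(X : M3) - 1‖ ≤ (n : ℝ)⁻¹ * ‖H'‖ := h1.trans h2.le
      _ ≤ (n : ℝ)⁻¹ * (π + 2 * π / 3) := by gcongr
      _ ≤ (n : ℝ)⁻¹ * (2 * π) :=
          mul_le_mul_of_nonneg_left (by linarith [Real.pi_pos]) (inv_nonneg.2 hn0.le)
      _ = 2 * π / n := by ring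

/-! ### The dial elements `e^{iθK}`, `K = diag(1, −1, 0)` -/

/-- `K = diag(1, −1, 0)`, a traceless Hermitian generator. [folklore] -/
def dialK : M3 := Matrix.diagonal ![(1 : ℂ), -1, 0]

/-- `K` is Hermitian. [folklore] -/
theorem dialK_isSelfAdjoint : IsSelfAdjoint dialK := by
  rw [IsSelfAdjoint, dialK, Matrix.star_eq_conjTranspose, diagonal_conjTranspose]
  congr 1
  funext i
  fin_cases i <;> simp

/-- `iK` is skew-Hermitian. [folklore] -/
theorem dialK_skew : (I • dialK)ᴴ = -(I • dialK) := by
  rw [conjTranspose_smul, ← Matrix.star_eq_conjTranspose, dialK_isSelfAdjoint.star_eq,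
    Complex.star_def, conj_I, neg_smul]

/-- `iK` is traceless. [folklore] -/
theorem dialK_trace : (I • dialK).trace = 0 := by
  rw [trace_smul, dialK, trace_diagonal, Fin.sum_univ_three]
  simp

/-- **The dial** `dial θ = e^{iθK} ∈ SU(3)`. [folklore] -/
def dial (θ : ℝ) : SU3' := expSU dialK_skew dialK_trace θ

/-- The dial is the diagonal matrix `diag(e^{iθ}, e^{-iθ}, 1)`. [folklore] -/
theorem coe_dial (θ : ℝ) :
    ((dial θ : SU3') : M3) = Matrix.diagonal ![Complex.exp (θ * I), Complex.exp (-(θ * I)), 1] := by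
  rw [dial, coe_expSU, dialK, RCLike.real_smul_eq_coe_smul (K := ℂ) θ, smul_smul, ← diagonal_smul,
    Matrix.exp_diagonal]
  congr 1
  funext i
  rw [Pi.coe_exp, ← congrFun Complex.exp_eq_exp_ℂ]
  fin_cases i
  · simp
  · simp
  · simp

/-- `Re tr (dial θ) = 1 + 2 cos θ` — what `decode` reads. [folklore] -/
theorem re_trace_dial (θ : ℝ) : ((dial θ : SU3') : M3).trace.re = 1 + 2 * Real.cos θ := by
  rw [coe_dial, trace_diagonal, Fin.sum_univ_three]
  simp only [Matrix.cons_val_zero, Matrix.cons_val_one, Matrix.cons_val, add_re, one_re]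
  rw [Complex.exp_ofReal_mul_I_re, show -(↑θ * I) = ((-θ : ℝ) : ℂ) * I by push_cast; ring,
    Complex.exp_ofReal_mul_I_re, Real.cos_neg]
  ring

/-- `‖dial θ − 1‖_op ≤ |θ|`. [folklore] -/
theorem norm_dial_sub_one_le (θ : ℝ) : ‖((dial θ : SU3') : M3) - 1‖ ≤ |θ| := by
  letI : CStarAlgebra M3 := {}
  set Ksa : selfAdjoint M3 := ⟨dialK, dialK_isSelfAdjoint⟩ with hKsa
  have hcoe : ((dial θ : SU3') : M3) = (expUnitary (θ • Ksa) : M3) := by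
    rw [dial, coe_expSU, expUnitary_coe, selfAdjoint.val_smul, smul_comm]
  have h1 : ‖((dial θ : SU3') : M3) - 1‖ ≤ ‖((θ • Ksa : selfAdjoint M3) : M3) - ((0 : selfAdjoint M3) : M3)‖ := by
    rw [hcoe, ← show ((expUnitary (0 : selfAdjoint M3) : Matrix.unitaryGroup (Fin 3) ℂ) : M3) = 1 by
      rw [expUnitary_zero]; rfl]
    exact norm_expUnitary_sub_expUnitary_le _ _
  have hK : ‖dialK‖ ≤ 1 := by
    rw [dialK, l2_opNorm_diagonal, pi_norm_le_iff_of_nonneg zero_le_one]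
    intro i
    fin_cases i <;> simp
  calc ‖((dial θ : SU3') : M3) - 1‖ ≤ ‖((θ • Ksa : selfAdjoint M3) : M3) - ((0 : selfAdjoint M3) : M3)‖ := h1
    _ = |θ| * ‖dialK‖ := by
        rw [ZeroMemClass.coe_zero, sub_zero, selfAdjoint.val_smul, norm_smul, Real.norm_eq_abs]
    _ ≤ |θ| * 1 := by gcongr
    _ = |θ| := mul_one _

end Summit.QuantumFields.QCD.Theorems.RobustYangMillsRG.Negative

end
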